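import Literature.Claims.NS.Fox2026

/-!
# C109 `Fox2026` — refuter kernel facts (D-0090 NS-CLAIMS; refuter-8)

Over the typed skeleton `Literature.Claims.NS.Fox2026` (typist-11, p470247; Zenodo 10.5281/zenodo.22049018,
GitHub snapshot `DavidFox998-navier-stokes-310212a`), whose own records are `topTheoremType_holds` (the
deposit's top TYPE `NS_M6_OPEN` is inhabited by a piecewise-in-time family — the two-field "solution" notion
`NS_WeakSolution` carries no equation) and `step_bridge_iff_claimedTheorem`:

* `not_Step_1` — the closing term of `NS_M6_PROVED` (NSPhase108LimitPass.lean:169–183) exhibits the ZERO family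
  for every datum and closes `init` by `rfl`; as a statement over all `L²` data, "the zero family has initial
  value `v₀`" is false (witness: the indicator of the closed unit ball times a unit vector, `bump`).
* `not_Step_ESS` — the deposit's one named mathematical axiom `NS_ESS_Criterion` (NSPhase86M6Close.lean:61–75),
  transcribed verbatim over the SAME equation-free structure, is false: the family `pw bump` (= `bump` at
  `t = 0`, zero afterwards) is an `NS_WeakSolution` with uniformly small weak-`L³` superlevel sets, yet the
  space-time field is not even continuous at `(0, 0)`. Over its own definitions the artefact's axiom is thus
  refutable (an inconsistent environment), independently of the Escauriaza–Seregin–Šverák theorem it cites,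
  which concerns Leray–Hopf solutions of the Navier–Stokes equations.

WHAT THIS IS NOT: not a claim about NS regularity or blow-up; not a claim about any author beyond the typed locator.
-/

set_option linter.dupNamespace false

noncomputable section

open Set Function Filter MeasureTheory
open scoped Topology ENNReal NNReal ContDiff

namespace Summit.NavierStokesRegularity.NavierStokesRegularity.Theorems.Fox2026

open Literature.Claims.NS.Fox2026

/-- The piecewise-in-time family: the datum at `t = 0`, the zero field at every other time (the witness of
the skeleton's `topTheoremType_holds`). -/
def pw (v₀ : EuclideanSpace ℝ (Fin 3) → EuclideanSpace ℝ (Fin 3)) :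
    ℝ → EuclideanSpace ℝ (Fin 3) → EuclideanSpace ℝ (Fin 3) :=
  fun t => if t = 0 then v₀ else 0

/-- `pw v₀ 0 = v₀`. -/
theorem pw_zero (v₀ : EuclideanSpace ℝ (Fin 3) → EuclideanSpace ℝ (Fin 3)) : pw v₀ 0 = v₀ := by simp [pw]

/-- `pw v₀ t = 0` for `t ≠ 0`. -/
theorem pw_of_ne (v₀ : EuclideanSpace ℝ (Fin 3) → EuclideanSpace ℝ (Fin 3)) {t : ℝ} (ht : t ≠ 0) :
    pw v₀ t = 0 := by simp [pw, ht]

/-- Every piecewise family is an `NS_WeakSolution` of the deposit (no equation is asked). -/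
theorem pw_weakSolution (v₀ : EuclideanSpace ℝ (Fin 3) → EuclideanSpace ℝ (Fin 3)) :
    NS_WeakSolution (pw v₀) v₀ := by
  refine ⟨pw_zero v₀, fun t _ => ?_⟩
  rcases eq_or_ne t 0 with rfl | hne
  · exact le_rfl
  · rw [pw_of_ne v₀ hne, pw_zero]
    simp only [Pi.zero_apply, norm_zero, ne_eq, OfNat.ofNat_ne_zero, not_false_eq_true, zero_pow,
      integral_zero]
    exact integral_nonneg fun x => by positivity

/-- A nonzero `L²` datum: the indicator of the closed unit ball times the unit vector `e₀`. -/
def bump : EuclideanSpace ℝ (Fin 3) → EuclideanSpace ℝ (Fin 3) :=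
  (Metric.closedBall (0 : EuclideanSpace ℝ (Fin 3)) 1).indicator fun _ => EuclideanSpace.single 0 1

/-- `bump ∈ L²`. -/
theorem bump_memLp : MemLp bump 2 (volume : Measure (EuclideanSpace ℝ (Fin 3))) := by
  unfold bump
  exact memLp_indicator_const 2 measurableSet_closedBall _ (Or.inr measure_closedBall_lt_top.ne)

/-- `bump 0 = e₀`. -/
theorem bump_at_zero : bump 0 = EuclideanSpace.single 0 1 := by
  simp [bump, Set.indicator_of_mem, Metric.mem_closedBall, dist_self]

/-- `bump ≠ 0` (its value at the origin is `e₀`, whose `0`-th coordinate is `1`). -/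
theorem bump_ne_zero : bump ≠ 0 := by
  intro h
  have h0 := congrArg (fun f => f 0 0) h
  rw [bump_at_zero] at h0
  simp at h0

/-- **`Step_1` is false**: the closing term's `init := rfl` slot for the zero witness
(NSPhase108LimitPass.lean:181–182), read over all `L²` data, fails at `v₀ = bump ≠ 0`. -/
theorem not_Step_1 : ¬ Literature.Claims.NS.Fox2026.Step_1 := by
  intro h
  exact bump_ne_zero (h bump bump_memLp).symm

/-- The superlevel sets of `pw bump` are uniformly small in weak-`L³`: with `B = |closed unit ball|` and
`M = max 1 B`, `|{x : l < ‖pw bump t x‖}| ≤ (M / l)³` for all `t ≥ 0`, `l > 0` (the set is inside the ball for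
`l < 1` and empty otherwise). -/
theorem pw_bump_weakL3 :
    ∃ M : ℝ, ∀ t : ℝ, 0 ≤ t → ∀ l : ℝ, 0 < l →
      volume {x | ENNReal.ofReal l < ‖pw bump t x‖ₑ} ≤ ENNReal.ofReal (M / l) ^ 3 := by
  set B : ℝ≥0∞ := volume (Metric.closedBall (0 : EuclideanSpace ℝ (Fin 3)) 1) with hB
  have hBfin : B ≠ (⊤ : ℝ≥0∞) := measure_closedBall_lt_top.ne
  refine ⟨max 1 B.toReal, fun t _ l hl => ?_⟩
  rcases eq_or_ne t 0 with rfl | hne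
  · rw [pw_zero]
    by_cases hl1 : l < 1
    · have hsub : {x : EuclideanSpace ℝ (Fin 3) | ENNReal.ofReal l < ‖bump x‖ₑ} ⊆
          Metric.closedBall (0 : EuclideanSpace ℝ (Fin 3)) 1 := by
        intro x hx
        by_contra hxB
        simp only [Set.mem_setOf_eq, bump, Set.indicator_of_notMem hxB, enorm_zero] at hx
        exact absurd hx (not_lt.mpr (zero_le))
      have hM1 : (1 : ℝ) ≤ max 1 B.toReal / l := by
        rw [le_div_iff₀ hl]
        nlinarith [le_max_left (1 : ℝ) B.toReal]
      calc volume {x : EuclideanSpace ℝ (Fin 3) | ENNReal.ofReal l < ‖bump x‖ₑ}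
          ≤ B := measure_mono hsub
        _ ≤ ENNReal.ofReal (max 1 B.toReal) := by
            rw [ENNReal.le_ofReal_iff_toReal_le hBfin (by positivity)]
            exact le_max_right _ _
        _ ≤ ENNReal.ofReal (max 1 B.toReal / l) := by
            apply ENNReal.ofReal_le_ofReal
            rw [le_div_iff₀ hl]
            have : 0 ≤ max 1 B.toReal := by positivity
            nlinarith [le_max_left (1 : ℝ) B.toReal]
        _ ≤ ENNReal.ofReal (max 1 B.toReal / l) ^ 3 := by
            apply le_self_pow₀
            · rw [← ENNReal.ofReal_one]
              exact ENNReal.ofReal_le_ofReal hM1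
            · norm_num
    · have hempty : {x : EuclideanSpace ℝ (Fin 3) | ENNReal.ofReal l < ‖bump x‖ₑ} = ∅ := by
        ext x
        simp only [Set.mem_setOf_eq, Set.mem_empty_iff_false, iff_false, not_lt]
        have hle : ‖bump x‖ ≤ 1 := by
          unfold bump
          by_cases hx : x ∈ Metric.closedBall (0 : EuclideanSpace ℝ (Fin 3)) 1
          · rw [Set.indicator_of_mem hx]; simp
          · rw [Set.indicator_of_notMem hx, norm_zero]; exact zero_le_one
        calc ‖bump x‖ₑ = ENNReal.ofReal ‖bump x‖ := (ofReal_norm _).symm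
          _ ≤ ENNReal.ofReal 1 := ENNReal.ofReal_le_ofReal hle
          _ ≤ ENNReal.ofReal l := ENNReal.ofReal_le_ofReal (not_lt.mp hl1)
      rw [hempty, measure_empty]
      exact zero_le
  · have hempty : {x : EuclideanSpace ℝ (Fin 3) | ENNReal.ofReal l < ‖pw bump t x‖ₑ} = ∅ := by
      ext x
      simp [pw_of_ne bump hne]
    rw [hempty, measure_empty]
    exact zero_le

/-- The space-time field `(t, x) ↦ pw bump t x` is not continuous (at `(0, 0)` it equals `e₀`, along
`t = 1/(n+1) → 0` it is `0`). -/
theorem pw_bump_not_continuous :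
    ¬ Continuous (fun tx : ℝ × EuclideanSpace ℝ (Fin 3) => pw bump tx.1 tx.2) := by
  intro hc
  let g : ℝ → EuclideanSpace ℝ (Fin 3) := fun t => pw bump t 0
  have hg : Continuous g := hc.comp (Continuous.prodMk continuous_id continuous_const)
  have hseq : Tendsto (fun n : ℕ => 1 / ((n : ℝ) + 1)) atTop (𝓝 0) := tendsto_one_div_add_atTop_nhds_zero_nat
  have hlim : Tendsto (g ∘ fun n : ℕ => 1 / ((n : ℝ) + 1)) atTop (𝓝 (g 0)) := (hg.tendsto 0).comp hseq
  have hconst : (g ∘ fun n : ℕ => 1 / ((n : ℝ) + 1)) = fun _ => 0 := by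
    funext n
    have hn : (1 : ℝ) / ((n : ℝ) + 1) ≠ 0 := by positivity
    show pw bump (1 / ((n : ℝ) + 1)) 0 = 0
    rw [pw_of_ne bump hn]
    rfl
  rw [hconst] at hlim
  have h0 : g 0 = 0 := (tendsto_nhds_unique tendsto_const_nhds hlim).symm
  have h1 : g 0 0 = 1 := by simp [g, pw_zero, bump_at_zero]
  rw [h0] at h1
  simp at h1

/-- **`Step_ESS` is false**: the deposit's axiom `NS_ESS_Criterion`, over its own equation-free
`NS_WeakSolution`, fails at `u₀ = bump`, `u = pw bump` (hypotheses by `pw_weakSolution`, `pw_bump_weakL3`;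
conclusion would make the space-time field `C^∞`, hence continuous — `pw_bump_not_continuous`). -/
theorem not_Step_ESS : ¬ Literature.Claims.NS.Fox2026.Step_ESS := by
  intro h
  have hcd := h bump (pw bump) (pw_weakSolution bump) pw_bump_weakL3 1 one_pos
  exact pw_bump_not_continuous hcd.continuous

end Summit.NavierStokesRegularity.NavierStokesRegularity.Theorems.Fox2026

end
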